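/-
Copyright (c) 2026 the pub-hodgecm-mathlib formalisation cell (harness21).  Seat LD2-p02 (g0), organ A₂ ∕ (R) of the LD lines, 2026-09-02.
Statement-only Literature module: ONE named fact, no proof.  v2 (LD2-p02 (g2), 2026-09-02T05:21Z): + the AMF-free reading line (LD-ref1 pre-box);
statement bytes = v1 975b4095b9e11d64.  Files on the dealer's word (LEAD «LD-R3′» Path Y nods the +1).
-/
import Literature.NumberTheory.Rogawski1990.CurveThetaHodgeTypeNecessity
import Literature.NumberTheory.Automorphic.Liu2021.ThetaLiftFromLineCharacters
import HarnessLib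

/-!
# [Liu2021, proof of Prop. D.4 (1) (p. 131 L8–21) via Thm. B.4 (1)] — letter (A₂-P): a HOLOMORPHIC `H¹`-class of the CM unitary CURVE `U(H)` with a
# θ-TYPE finite component AT THE LABEL `λ` is NOT ORTHOGONAL to the global theta lifts from some hermitian LINE at the `λ`-splitting

Topic `NumberTheory/Automorphic/Liu2021`; namespace `Literature.NumberTheory.Automorphic.Liu2021`.  STATEMENT-ONLY: ONE closed named fact
`def curveHolTheta_nonOrthogonal₂ : Prop`.  Cell hodgecm-mathlib FLOOR 0, crux `HLiu418`: the LETTER HALF (A₂-P) of organ A₂ `ThetaRealisation₂` of line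
LD2 (`Lines/F0_P6LD_StubS1bFactsOrganRoad.lean`) = organ (R) of line LD1 (`Lines/F0_P6LD_StubS1FactsThetaRoad.lean`); the in-house half (A₂-J)
«non-orthogonality ⟹ `MeetsThetaLiftFromLine`» is ★ `Summit…F0LD2MeetsOfNonOrthogonal.meetsThetaLiftFromLine_of_starProjection_ne_zero` (p849185).
Frame = the curve letters' frame VERBATIM (★ `Rogawski1990.curveThetaHodgeTypeNecessity_hol`: `L` CM with `4 ≤ [L:ℚ]`, `ι`, `H ∈ M₂(L)` with a
rational frame `formCongr c g (t • H) = diag dV` of signature `(1,1)` at `ι` and definite at the other complex places, cone frame `𝔣`, label `λ`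
conjugate symplectic of weight one, line `a`, `χ ∈ Chi`, irreducible smooth `σ` with an injective `j : σ → ω(λ, ε_a, χ)_f ∘ (finAdelicCongr … g ht hg)⁻¹`,
`P` discrete of Hodge type `(1,0)` at `ι` with finite component `σ`), plus the PINNED adelic transport `ιA` (`↑(ιA k) = g_𝔸⁻¹ k g_𝔸`, which exists:
★ `F0LD2ArchAdmissibleAssembly.exists_adelicFrameTransport_smul`) and the displayed compactness binder of the T5 seam.

PRINT.  [Liu2021, App. D, proof of Prop. D.4 (1), p. 131 L8–21]: «The global inner transfer from `U(V)` to `U(V*)` is known [Har93] … The Langlands–Arthur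
classification for `U(V*)` is known by [Rog90, §11] … Suppose that `π^∞` is endoscopic cohomological. Then … `BC(π) = χ₁ ⊞ χ₂` … there exists a conjugate
symplectic automorphic character `μ` of weight one such that `L(s, Π ⊗ μ)` has a simple pole at `s = 1`.  By Theorem B.4, we have a skew-hermitian space `W`
over `E` of rank 1 … and an automorphic character `χ′` of `U(W)(𝔸_F)`, such that `π` is realized in the space of global theta lifting `Θ^V_{ψ_F,(μ,ν),W}(χ′)`.»
with [Thm. B.4 (1), p. 98] «(a) `L^S(s, π × μ) · L^S(2s, μ, As)` has a pole at `s₀` … (c) `Θ^W_{(μ,ν),V}(V_π) ≠ 0` for some skew-hermitian `W` of dimension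
`n + 1 − 2s₀`; (a) ⇒ (b) ⇒ (c)» at `n = 2`, `s₀ = 1` (a LINE).  HERE the label is PINNED: the θ-type finite component `σ ↪ ω(λ, ε_a, χ)_f` has local base
change `λ_v ⊞ λᶜ_v χ̌_v` at almost every place ([Lem. D.1 (3)]), so `{χ₁, χ₂} ∋ λ` up to the companion by strong multiplicity one for isobaric sums
[JacquetShalika1981, Thm. 4.4], and the pole is at `μ = λ` (Liu's normalisation, footnote l. 2136: «replaced by its inverse»).  `Θ^W(V_π) ≠ 0` is a PAIRING
statement: `⟨θ^W_Φ(φ), f⟩_{[U(W)]} ≠ 0` for some `φ ∈ V_π`, `Φ`, `f`, i.e. (Fubini on the two compact quotients, the theta kernel being jointly continuous)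
`⟨φ, Θ̃_Φ(f̄)⟩_{[U(V)]} ≠ 0`, i.e. the orthogonal projection to `P = V_π` of the class `[Θ̃_Φ(f̄) ∘ ιA]` is non-zero — the typed conclusion.

HONEST SCOPE.  (o) AMF-FREE READING (Path Y, LEAD «LD-R3′» 2026-09-02T05:11:42Z; LD-ref1 pre-box 05:17:05Z): what this letter ASSERTS needs only the pole of the
partial `L`-function attached to the unramified local types of `σ` and [Thm. B.4 (1)] (a) ⇒ (c) (doubling ∕ Siegel–Weil, [Liu2021, §B.3]); Arthur's multiplicity
formula, [Rogawski1990, §11] and [Harris1993] serve the existence ∕ multiplicity half of Prop. D.4 (1) only and are NOT prerequisites of the typed statement.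
(i) DEEP: inner transfer [Harris1993], Rogawski's classification [Rogawski1990, §11], the pole ⟹ theta theorem [GinzburgJiangSoudry2009] ∕
[Liu2021, §B.3]; no carrier in the tree (no automorphic `L`-functions of `U(2) × GL₁`, no Siegel–Weil); recorded as the printed road.  (ii) Junk: without
`IsHolCotangentAt₂` false (supercuspidal `P`); without the θ-type finite component at `λ` only `∃ μ` holds (that is ★ letter A `cohHol_meetsThetaLiftFromLine`'s
shape, n = 3); orientation-free (the cone's sign is never read: the `(0,1)` twin holds verbatim).  (iii) Serves BOTH leaves through (A₂-J) + multiplicity one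
(★ letter `Rogawski1990.curveMultiplicityLeOne`) + irreducibility of the character theta span (★ letter `Liu2021.ThetaLiftFromLineIrreducible`, LD1 (F3)).
HC_CM is proved only modulo the printed citations until rung 0 closes; filing this file books ONE printed statement (+1).

## References
* [Liu2021] Y. Liu, Camb. J. Math. 9 (2021) = arXiv:2102.11518: App. D, proof of Prop. D.4 (1) (p. 130 L34 – p. 131 L21); App. B Thm. B.4 (1) (p. 98),
  footnote l. 4289; proof of Prop. 4.13 Case 1 (l. 2129–2137); Lem. D.1 (3).
* [Rogawski1990] J. Rogawski, Ann. of Math. Stud. 123 (1990), §11, Thm. 11.5.1; Thm. 13.3.6.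
* [Harris1993] M. Harris, J. AMS 6 (1993), Thm. 2.6.3.
* [JacquetShalika1981] H. Jacquet, J. Shalika, Amer. J. Math. 103 (1981), Thm. 4.4.
* [GinzburgJiangSoudry2009] D. Ginzburg, D. Jiang, D. Soudry, J. Inst. Math. Jussieu 8 (2009), Thm. 1.1.
-/

noncomputable section

open NumberField NumberField.InfinitePlace MeasureTheory IsDedekindDomain
open scoped Matrix ComplexOrder

namespace Literature.NumberTheory.Automorphic.Liu2021

open _root_.MeasureTheory
open Literature.NumberTheory.Automorphic Literature.NumberTheory.Automorphic.UnitaryGroup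
open Literature.NumberTheory.Automorphic.UnitaryGroup.CotangentForms
open Literature.NumberTheory.Automorphic.UnitaryCurveForms
open Literature.NumberTheory.Automorphic.IdeleClassGroup
open Literature.NumberTheory.Automorphic.Liu2021.Def411WeilCarriers
open Literature.NumberTheory.Automorphic.Liu2021.Def411WeilCarriersDoubling
open Literature.NumberTheory.GaloisRepresentations
open Literature.NumberTheory.GelbartRogawski1991 Literature.NumberTheory.GelbartRogawski1991.UnitaryDualPair
open Literature.NumberTheory.Weil1964
open Literature.RepresentationTheory.Liu2021 Literature.RepresentationTheory.HarrisKudlaSweet1996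

/-- **Letter (A₂-P) [Liu2021, proof of Prop. D.4 (1) p. 131 L8–21 via Thm. B.4 (1)] — «a holomorphic `H¹`-class of `U(H)` with θ-type finite component
`σ ↪ ω(λ, ε_a, χ)_f` is NOT ORTHOGONAL to the global theta lifts from some hermitian LINE `⟨a′⟩` at the `λ`-splitting»: in the curve letters' frame, for the
pinned adelic transport `ιA`, every discrete `P` of Hodge type `(1,0)` at `ι` with finite component `σ` admits a line `a′`, a Weil-majorant witness, a finite
invariant measure on `[U(⟨a′⟩)]`, a continuous weight `f`, a Schwartz–Bruhat `Φ` and a square-integrability witness such that the orthogonal projection to `P`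
of the theta class `[x ↦ Θ̃_Φ(f)(ιA x)]` is NON-ZERO.  AMF-free reading (LD-ref1 (g0) pre-box 2026-09-02T05:17:05Z, Path Y): the pole is that of the PARTIAL
`L`-function `L^S(s, π × μ) · L^S(2s, μ, As)` of [Thm. B.4 (1) (a)], attached to the unramified local types of `σ` ([Lem. D.1 (3)]; Hecke ∕ Tate pole, edge
non-vanishing [JacquetShalika1981, Thm. 4.4]), and B.4 itself is proved in [Liu2021, §B.3] by the doubling ∕ Siegel–Weil method; [Rogawski1990, §11] and
[Harris1993] enter Liu's paragraph only for the existence ∕ multiplicity half of Prop. D.4 (1), which this letter does NOT assert — they are context citations here.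
[cite: Liu2021, App. D proof of Prop. D.4 (1) (p. 131 L8–21); App. B Thm. B.4 (1) (p. 98); proof of Prop. 4.13 Case 1 (l. 2129–2137); Lem. D.1 (3)]
[cite: JacquetShalika1981, Thm. 4.4] [cite: GinzburgJiangSoudry2009, Thm. 1.1] [cite: Rogawski1990, §11 Thm. 11.5.1] [cite: Harris1993, Thm. 2.6.3] -/
def curveHolTheta_nonOrthogonal₂ : Prop :=
  ∀ (L : Type) [Field L] [NumberField L] [IsCMField L] (ι : L →+* ℂ) (H : Matrix (Fin 2) (Fin 2) L)
    (dV : Fin 2 → L) (hdV : ∀ i, IsCMField.complexConj L (dV i) = dV i) (hdV0 : ∀ i, dV i ≠ 0)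
    (t : L) (ht : t ≠ 0) (g : GL (Fin 2) L)
    (hg : formCongr ((IsCMField.complexConj L : L ≃ₐ[↥(maximalRealSubfield L)] L) : L →+* L) g (t • H) = Matrix.diagonal dV),
    (∃ T : GL (Fin 2) ℂ, formCongr (starRingEnd ℂ) T ((Matrix.diagonal dV).map ι) = Matrix.diagonal ![(1 : ℂ), -1]) →
    (∀ τ' : L →+* ℂ, InfinitePlace.mk τ' ≠ InfinitePlace.mk ι → ((Matrix.diagonal dV).map τ').PosDef) →
    4 ≤ Module.finrank ℚ L →
    ∀ (𝔣 : ConeFrame L H (cmPlace L ι))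
      (μ : Measure (adelicGroupData (↥(maximalRealSubfield L)) L (IsCMField.complexConj L) 2 H).automorphicQuotient)
      [(adelicGroupData (↥(maximalRealSubfield L)) L (IsCMField.complexConj L) 2 H).IsAutomorphicMeasure μ]
      {n' : ℕ} (e₁ : Fin 2 × Fin 1 ≃ Fin n')
      (lam : Literature.NumberTheory.Automorphic.IdeleClassGroup L →ₜ* Circle) (hlam : IsConjugateSymplectic L lam), HasWeight L lam 1 →
    ∀ (a : (↥(maximalRealSubfield L))ˣ) (χ : Chi (↥(maximalRealSubfield L)) L (IsCMField.complexConj L))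
      (W : Type) [AddCommGroup W] [Module ℂ W]
      (σ : Representation ℂ (finAdelic (↥(maximalRealSubfield L)) L (IsCMField.complexConj L) 2 H) W),
      σ.IsIrreducible → σ.IsSmooth →
    ∀ j : σ.IntertwiningMap
        ((rhoVAtLine (↥(maximalRealSubfield L)) L (IsCMField.complexConj L) 2 e₁ (Matrix.diagonal dV)
            (complexConj_imagUnit L) (imagUnit_ne_zero L) (imagUnit_mul_self L) (realDiagonal_isSymm L dV hdV)
            (isUnit_det_realDiagonal L dV hdV hdV0) (realDiagonal_map L dV hdV).symm
            (fun a => isCompatible_chiSplittingLine L e₁ dV hdV hdV0 (toHeckeCharacter L lam)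
              (isUnitary_toHeckeCharacter L lam) ((isOscillatorChar_toHeckeCharacter_iff lam).mpr hlam)
              (TW (↥(maximalRealSubfield L)) a) (isSymm_TW (↥(maximalRealSubfield L)) a)
              (isUnit_det_TW (↥(maximalRealSubfield L)) a) (JW (↥(maximalRealSubfield L)) L a)
              (JW_eq (↥(maximalRealSubfield L)) L a)) a χ).comp
          (finAdelicCongr (↥(maximalRealSubfield L)) L (IsCMField.complexConj L) g ht hg).symm.toMonoidHom),
      Function.Injective j →
    ∀ (ιA : (adelicGroupData (↥(maximalRealSubfield L)) L (IsCMField.complexConj L) 2 H).Adelic →*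
        ↥(UnitaryGroup.adelic (↥(maximalRealSubfield L)) L (IsCMField.complexConj L) 2 (Matrix.diagonal dV))),
      (∀ k, ((ιA k : ↥(UnitaryGroup.adelic (↥(maximalRealSubfield L)) L (IsCMField.complexConj L) 2 (Matrix.diagonal dV))) :
            GL (Fin 2) (AdeleRing (𝓞 L) L)) =
          (toAdeleGL L g)⁻¹ * adelicVal (↥(maximalRealSubfield L)) L (IsCMField.complexConj L) 2 H k * toAdeleGL L g) →
    ∀ [CompactSpace (↥(UnitaryGroup.adelic (↥(maximalRealSubfield L)) L (IsCMField.complexConj L) 2 (Matrix.diagonal dV)) ⧸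
        (UnitaryGroup.toAdelic (↥(maximalRealSubfield L)) L (IsCMField.complexConj L) 2 (Matrix.diagonal dV)).range)]
      [CompactSpace (adelicGroupData (↥(maximalRealSubfield L)) L (IsCMField.complexConj L) 2 H).automorphicQuotient],
    ∀ P : DiscreteAutomorphicRep (adelicGroupData (↥(maximalRealSubfield L)) L (IsCMField.complexConj L) 2 H) μ,
      P.IsHolCotangentAt₂ (IsCMField.complexConj_ne_one L) (UnitaryGroup.complexConj_smul_infinitePlace L) (cmPlace L ι) 𝔣 →
      P.HasFinComponent σ →
      ∃ a' : (↥(maximalRealSubfield L))ˣ,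
        letI : MeasurableSpace (↥(UnitaryGroup.adelic (↥(maximalRealSubfield L)) L (IsCMField.complexConj L) 1 (JW (↥(maximalRealSubfield L)) L a')) ⧸
            (UnitaryGroup.toAdelic (↥(maximalRealSubfield L)) L (IsCMField.complexConj L) 1 (JW (↥(maximalRealSubfield L)) L a')).range) := borel _
        haveI := normal_range_toAdelic_JW L a'
        ∃ (hρ : HasThetaMajorants fun
            (p : ↥(UnitaryGroup.adelic (↥(maximalRealSubfield L)) L (IsCMField.complexConj L) 2 (Matrix.diagonal dV)) ×
              ↥(UnitaryGroup.adelic (↥(maximalRealSubfield L)) L (IsCMField.complexConj L) 1 (JW (↥(maximalRealSubfield L)) L a')))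
              (Φ : piSchwartzBruhat (↥(maximalRealSubfield L)) (Fin n')) =>
              pairRep (↥(maximalRealSubfield L)) L (IsCMField.complexConj L) 2 1 e₁ (Matrix.diagonal dV) (JW (↥(maximalRealSubfield L)) L a')
                (chiSplittingLine L e₁ dV hdV hdV0 (toHeckeCharacter L lam) (isUnitary_toHeckeCharacter L lam)
                  ((isOscillatorChar_toHeckeCharacter_iff lam).mpr hlam) (TW (↥(maximalRealSubfield L)) a')
                  (isUnit_det_TW (↥(maximalRealSubfield L)) a') (JW (↥(maximalRealSubfield L)) L a') (JW_eq (↥(maximalRealSubfield L)) L a'))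
                p Φ)
          (μW : Measure (↥(UnitaryGroup.adelic (↥(maximalRealSubfield L)) L (IsCMField.complexConj L) 1 (JW (↥(maximalRealSubfield L)) L a')) ⧸
            (UnitaryGroup.toAdelic (↥(maximalRealSubfield L)) L (IsCMField.complexConj L) 1 (JW (↥(maximalRealSubfield L)) L a')).range))
          (_ : IsFiniteMeasure μW)
          (_ : SMulInvariantMeasure ↥(UnitaryGroup.adelic (↥(maximalRealSubfield L)) L (IsCMField.complexConj L) 1 (JW (↥(maximalRealSubfield L)) L a'))
            (↥(UnitaryGroup.adelic (↥(maximalRealSubfield L)) L (IsCMField.complexConj L) 1 (JW (↥(maximalRealSubfield L)) L a')) ⧸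
              (UnitaryGroup.toAdelic (↥(maximalRealSubfield L)) L (IsCMField.complexConj L) 1 (JW (↥(maximalRealSubfield L)) L a')).range) μW)
          (f : C((↥(UnitaryGroup.adelic (↥(maximalRealSubfield L)) L (IsCMField.complexConj L) 1 (JW (↥(maximalRealSubfield L)) L a')) ⧸
            (UnitaryGroup.toAdelic (↥(maximalRealSubfield L)) L (IsCMField.complexConj L) 1 (JW (↥(maximalRealSubfield L)) L a')).range), ℂ))
          (Φ : piSchwartzBruhat (↥(maximalRealSubfield L)) (Fin n'))
          (hθ : MemLp (toQuotFun (adelicGroupData (↥(maximalRealSubfield L)) L (IsCMField.complexConj L) 2 H) fun x =>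
            (lineThetaKernelDatum L 2 e₁ dV hdV hdV0 lam hlam a' hρ).thetaLiftFun μW Φ f (ιA x)) 2 μ),
          P.space.toSubmodule.starProjection (MemLp.toLp _ hθ) ≠ 0

end Literature.NumberTheory.Automorphic.Liu2021

end
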